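import Literature.Barriers.AtomisticToContinuum.AnticontinuumLocalizationShortChains
import Literature.Barriers.AtomisticToContinuum.AnticontinuumLocalizationBounds2
import Literature.Barriers.AtomisticToContinuum.AnticontinuumLocalizationThm2Proof
import Literature.Barriers.AtomisticToContinuum.AnticontinuumLocalizationProofs
import HarnessLib

/-!
# De Roeck–Huveneers 2015, Theorem 1 on SHORT chains, II: bounds, window solutions without room; Theorem 1 and Theorem 4 for ALL chain lengths

`Literature/Barriers/AtomisticToContinuum/` — conclusion of `AnticontinuumLocalizationShortChains.lean`
(the short-chain splitting `F = θ_b H̃_{>b}`, `U = H^O_{>b} - 𝒯(RF)`, `B = {V, (RF)_n}`, `A = 0`).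
W. De Roeck, F. Huveneers, *Asymptotic localization of energy in nondisordered oscillator chains*,
CPAM **68** (2015), arXiv:1305.5127, print Theorem 1 "for any `N ≥ 1`" and prove it for long chains
(§5.5 Lemma 4 needs `n₂` separated sites: the tree's `windowSolutions_with_room`,
`DeRoeckHuveneers2015_thm1_largeN`). Here the short windows are supplied by the room-free variant
(`n₂ = m + 1`, so that `S(x) = ∅` and the resonant remainder `A` vanishes identically), and the two
are glued.

Part A — the pointwise bounds (following `AnticontinuumLocalizationBounds{,2}.lean`, §5.6 of the
source, line by line with the single cut-off `θ_b` in place of the partition `ϑ`):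
* symbolic representatives `RsgtSym` of `R F` (`(RF)_j ∼ δ^{-2j}`) and `BsymS` of `B`
  (`B ∼ δ^{-(2n+1)}`), with their evaluation identities;
* the decomposition `U = U⁽⁰⁾ + ε V_{>b} - ∑_{j≥1} ε^j (RF)_j` with `U⁽⁰⁾ = (1 - θ_b) D_{>b}`
  (`U0zeroS`) vanishing, with its gradient, off the single-resonance set `Z₁` (there `θ_b = 1`);
* `U0S_bound`: `|U| ≤ K (𝟙_{Z₁}(ω) + ∑_{j=1}^n ε^j δ^{-2j}) W^M`; `dU0S_bound`:
  `|∂U| ≤ K (𝟙_{Z₁}(ω) δ^{-1} + ∑_{j=1}^n ε^j δ^{-(2j+1)}) W^M`; `BtermS_bound`: `|B| ≤ K δ^{-(2n+1)} W^M`,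
  `|∂B| ≤ K δ^{-(2n+2)} W^M` (`W = 1 + ‖ω‖`; `K`, `M` independent of `ε ∈ [0,1]`, `δ ∈ (0,1]`, `q`, `ω`).

Part B — window solutions and the theorems:
* `windowSolutionS_of_cutoffs` — for cut-offs `Θ` on a window of `m < n₂` sites, a scheme radius
  `r` for `n₁ = 2n₀ + 1` stages and ANY locality radius `M ≥ m - 1`: `(U, G) = (U0S, G0S)` at
  `δ = ε^{1/4}` is a window solution (`IsWindowSolution`) for all `0 < ε < 1` — smooth, periodic,
  (trivially) local, `εJ = L_H U + ε^{n₀+1} G`, `⟨U²⟩ ≤ Cε^{1/4}`, `⟨|∇U|²⟩ ≤ Cε^{-1/4}`, `⟨G²⟩ ≤ C`,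
  `⟨|∇G|²⟩ ≤ C` (the majorant lemma of `…Majorant` with the single-resonance set `Z₁`; `G = ε^{n-n₀}B`);
* `shortWindowSolutions` — hence window solutions for EVERY window of at most `M + 1` sites;
* `windowSolutions_all` — with `windowSolutions_with_room`: window solutions for all windows;
* **`DeRoeckHuveneers2015_thm1_holds : DeRoeckHuveneers2015_thm1`** — Theorem 1 for every odd
  `N` (the proof nowhere uses oddness), by `DeRoeckHuveneers2015_thm1_of_windowSolutions`;
* **`DeRoeckHuveneers2015_thm4_holds : DeRoeckHuveneers2015_thm4`** — Theorem 4 (frozen interval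
  energies for all polynomial times), by the §7 reduction `DeRoeckHuveneers2015_thm4_of_thm1`
  (`…Proofs`); and `DeRoeckHuveneers2015_thm2_holds'`, Theorem 2 re-derived from Theorem 1 alone.

The short-chain case is not treated in the source; it is the finite-dimensional shadow of its
argument (constants depend on the window, which is harmless below a fixed size). All proved; no
named facts. [cite: DeRoeckHuveneers2015, §2.3 Thms 1, 2, 4; §5.6; §7]
-/

noncomputable section

open Function Set Finset Filter Metric
open scoped ContDiff BigOperators Topology

namespace Literature.Barriers.AtomisticToContinuum.HeatConduction.RotorChain

open Literature.MathematicalPhysics.KineticTheory.HeatConduction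
open Literature.Analysis.Calculus Literature.Analysis.Calculus.IsDeltaSymbol
open Literature.Algebra.Lie Literature.Algebra.Lie.TruncSeries

variable {m : ℕ}

section Objects

variable {r L n₂ : ℕ} (Θ : ResonanceCutoffs m r L n₂) (b : Fin m) (γ : ℝ) (n : ℕ)

/-! ### Symbolic representatives -/

/-- `F = θ_b H̃_{>b}` as a symbolic series. [folklore] -/
def sgtSeries : SymSeries m := fun j => sgtPoly Θ b γ n j

/-- The symbolic `R F`. [cite: DeRoeckHuveneers2015, §5.1 (`H_{>a} = 𝒯_{n₁}(R H̃_{>a})`), short-chain variant] -/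
def RsgtSym : SymSeries m := SymSeries.rOp n (gen m γ n) (fun _ => stageRad n n) n (bigRad m n) (sgtSeries Θ b γ n)

/-- The symbolic `B = {V, (R F)_n}`. [cite: DeRoeckHuveneers2015, §5.2 (the term `ε^{n₁+1} L_V ∑_k R^{(n₁-k)} H̃^{(k)}_{>a}`), short-chain variant] -/
def BsymS : TrigPoly m :=
  TrigPoly.bracket 1 (SymSeries.rRad n (fun _ => stageRad n n) n (bigRad m n)) (potPoly m γ) (RsgtSym Θ b γ n n)

variable {Θ b γ n}

/-- `sgtSeries` is good with the working radius at scales `δ ∈ (0,1]`. [folklore] -/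
theorem sgtSeries_good {δ : ℝ} (hδ : 0 < δ) (hδ1 : δ ≤ 1) : (sgtSeries Θ b γ n).Good n (bigRad m n) δ :=
  fun _ hj => sgtPoly_good hδ hδ1 hj

/-- `RsgtSym` represents `R F`. [folklore] -/
theorem RsgtSym_represents {δ : ℝ} (hδ : 0 < δ) (hδ1 : δ ≤ 1) :
    SymSeries.Represents δ n (RsgtSym Θ b γ n) (TruncSeries.rOp (genFun m γ n δ) n (sgtTS Θ b γ n δ)) :=
  SymSeries.Represents.rOp (gen_good_top γ n δ) (fun _ hk => val_genFun m γ n δ hk) n (sgtSeries_good hδ hδ1) (sgt_represents hδ hδ1)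

/-- `RsgtSym` is good. [folklore] -/
theorem RsgtSym_good {δ : ℝ} (hδ : 0 < δ) (hδ1 : δ ≤ 1) :
    (RsgtSym Θ b γ n).Good n (SymSeries.rRad n (fun _ => stageRad n n) n (bigRad m n)) δ :=
  SymSeries.Good.rOp (gen_good_top γ n δ) n (sgtSeries_good hδ hδ1)

/-- `F^{(j)} ∼ δ^{-2(j-1)} ≤ δ^{-2j}` (`θ_b` is a symbol of order `0`). [cite: DeRoeckHuveneers2015, §5.6 ("`H^O_{>a} - H_{>a} ∼ ∑_n ε^n δ^{-2n}`")] -/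
theorem sgtSeries_inClass : ∀ j ≤ n, (sgtSeries Θ b γ n j).InClass (2 * j) := by
  intro j hj
  have hN := normalForm_inClass m γ n j hj
  exact ((hN.filter (fun t => decide (b < t.pos))).smulFun (Θ.symbol b)).mono (by omega)

/-- **`(R F)_j ∼ δ^{-2j}`.** [cite: DeRoeckHuveneers2015, §5.6 ("the dominant contribution for each `n` coming from the `k = 0` term")] -/
theorem RsgtSym_inClass : ∀ j ≤ n, (RsgtSym Θ b γ n j).InClass (2 * j) := by
  intro j hj
  unfold RsgtSym
  have := inClass_rOp_affine (n := n) (fun k _ => gen_inClass m γ n k) (fun _ => stageRad n n) 0 n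
    (S := sgtSeries Θ b γ n) (r := bigRad m n) (fun j' hj' => (sgtSeries_inClass j' hj').mono (by omega)) j hj
  simpa using this

/-- **`𝒯R F = ∑_j ε^j ev (RF)_j`.** [folklore] -/
theorem eval_Rsgt_eq_sum {δ : ℝ} (hδ : 0 < δ) (hδ1 : δ ≤ 1) (ε : ℝ) (z : PhaseSpace m) :
    (TruncSeries.eval ε (TruncSeries.rOp (genFun m γ n δ) n (sgtTS Θ b γ n δ))).val z =
      ∑ j ∈ Finset.range (n + 1), ε ^ j * TrigPoly.ev (RsgtSym Θ b γ n j) δ z := by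
  rw [SmoothFun.val_eval]
  exact Finset.sum_congr rfl fun j hj => by rw [RsgtSym_represents hδ hδ1 j (Nat.lt_succ_iff.1 (Finset.mem_range.1 hj))]

/-- **`B = ev BsymS`.** [folklore] -/
theorem BtermS_eq_ev {δ : ℝ} (hδ : 0 < δ) (hδ1 : δ ≤ 1) (z : PhaseSpace m) :
    BtermS Θ b γ n δ z = TrigPoly.ev (BsymS Θ b γ n) δ z := by
  unfold BtermS BsymS
  have hV : (potPoly m γ).Good 1 δ := by
    have := hamSeries_good m 1 γ δ 1 le_rfl
    simpa [hamSeries] using this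
  have e : potentialEnergy m γ = TrigPoly.ev (potPoly m γ) δ := funext fun z => (ev_potPoly γ δ z).symm
  rw [e, RsgtSym_represents hδ hδ1 n le_rfl]
  exact (hV.poisson_ev_ev ((RsgtSym_good hδ hδ1) n le_rfl) z)

/-- `B ∼ δ^{-(2n+1)}`. [cite: DeRoeckHuveneers2015, §5.6 ("`∂_♯ L_V ∑_{k=0}^{n₁} R^{(n₁-k)} H̃^{(k)}_{>a} ∼ δ^{-2n₁-2}`")] -/
theorem BsymS_inClass : (BsymS Θ b γ n).InClass (2 * n + 1) := by
  have hV : (potPoly m γ).InClass 0 := potPoly_inClass m γ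
  have := hV.bracket (RsgtSym_inClass (Θ := Θ) (b := b) (γ := γ) (n := n) n le_rfl) 1
    (SymSeries.rRad n (fun _ => stageRad n n) n (bigRad m n))
  unfold BsymS
  simpa using this

/-! ### The order-`0` part of `U` -/

variable (Θ b) in
/-- `U⁽⁰⁾ = D_{>b} - θ_b D_{>b} = (1 - θ_b) D_{>b}` (a function of `ω`; written at phase points).
[cite: DeRoeckHuveneers2015, §5.6 (display for `(H^O_{>a} - H_{>a})^{(0)}`), short-chain variant] -/
def U0zeroS (δ : ℝ) (z : PhaseSpace m) : ℝ :=
  TrigPoly.ev (tailD b) δ z - Θ.θ b δ z.2 * TrigPoly.ev (tailD b) δ z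

/-- `ev (RF)_0 = ev F^{(0)} = θ_b D_{>b}`. [folklore] -/
theorem ev_RsgtSym_zero {δ : ℝ} (hδ : 0 < δ) (hδ1 : δ ≤ 1) (z : PhaseSpace m) :
    TrigPoly.ev (RsgtSym Θ b γ n 0) δ z = Θ.θ b δ z.2 * TrigPoly.ev (tailD b) δ z := by
  rw [← RsgtSym_represents hδ hδ1 0 (Nat.zero_le n), rOp_coeff_zero, val_sgtTS_coeff hδ hδ1 (Nat.zero_le n), ev_sgtPoly]
  simp only [tailD, normalForm, stage_apply_zero]

/-- **The decomposition of `U`**: `U = U⁽⁰⁾ + ε ev V_{>b} - ∑_{j=1}^n ε^j ev (RF)_j`. [cite: DeRoeckHuveneers2015, §5.6 ("`H^O_{>a} - H_{>a} = ∑_{n=0}^{n₁} ε^n (H^O_{>a} - H_{>a})^{(n)}`")] -/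
theorem U0S_decomp {δ : ℝ} (hδ : 0 < δ) (hδ1 : δ ≤ 1) (ε : ℝ) (z : PhaseSpace m) :
    U0S Θ b γ n ε δ z = U0zeroS Θ b δ z + ε * TrigPoly.ev (tailV b γ) δ z -
      ∑ j ∈ Finset.Ico 1 (n + 1), ε ^ j * TrigPoly.ev (RsgtSym Θ b γ n j) δ z := by
  unfold U0S U0zeroS
  rw [eval_Rsgt_eq_sum hδ hδ1, tailEnergy_eq_ev ε γ δ z, Finset.range_eq_Ico, Finset.sum_eq_sum_Ico_succ_bot (Nat.succ_pos n),
    pow_zero, one_mul, ev_RsgtSym_zero hδ hδ1]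
  ring

/-- **Off `Z₁` (radius `≥ R_S`), `θ_b = 1`.** [cite: DeRoeckHuveneers2015, §5.6 (definition of `W`), via `nearRes_of_lt_one`] -/
theorem theta_eq_one_of_not_mem_Z1set' {δ : ℝ} (hδ : 0 < δ) (hδ1 : δ ≤ 1) {R₁ : ℕ} (hR : Θ.RS ≤ R₁)
    {w : Fin m → ℝ} (hw : w ∉ Z1set m r b R₁ ((L : ℝ) ^ (n₂ + 1) * δ)) : Θ.θ b δ w = 1 :=
  theta_eq_one_of_not_mem_Z1set (n₃ := 0) hδ hδ1 (by simpa using hR) hw (self_mem_nearSites b 0)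

/-- **Off `Z₁`, `U⁽⁰⁾ = 0`.** [cite: DeRoeckHuveneers2015, §5.6 ("`(H^O_{>a} - H_{>a})^{(0)}(ω,q) = 0` for `(ω,q) ∈ Ω ∖ W`")] -/
theorem U0zeroS_eq_zero {δ : ℝ} (hδ : 0 < δ) (hδ1 : δ ≤ 1) {R₁ : ℕ} (hR : Θ.RS ≤ R₁) {z : PhaseSpace m}
    (hz : z.2 ∉ Z1set m r b R₁ ((L : ℝ) ^ (n₂ + 1) * δ)) : U0zeroS Θ b δ z = 0 := by
  unfold U0zeroS
  rw [theta_eq_one_of_not_mem_Z1set' hδ hδ1 hR hz, one_mul, sub_self]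

variable (Θ b γ n) in
/-- `U⁽⁰⁾` as one symbolic polynomial: `D_{>b} - F^{(0)}`. [folklore] -/
def U0zeroPolyS : TrigPoly m :=
  tailD b ++ TrigPoly.neg (sgtPoly Θ b γ n 0)

/-- `ev U0zeroPolyS = U⁽⁰⁾`. [folklore] -/
theorem ev_U0zeroPolyS (δ : ℝ) (z : PhaseSpace m) : TrigPoly.ev (U0zeroPolyS Θ b γ n) δ z = U0zeroS Θ b δ z := by
  unfold U0zeroPolyS U0zeroS
  rw [TrigPoly.ev_append, TrigPoly.ev_neg, ev_sgtPoly]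
  simp only [tailD, normalForm, stage_apply_zero]
  ring

/-- `U0zeroPolyS` is of order `0`. [folklore] -/
theorem U0zeroPolyS_inClass : (U0zeroPolyS Θ b γ n).InClass 0 := by
  unfold U0zeroPolyS
  have h := sgtSeries_inClass (Θ := Θ) (b := b) (γ := γ) (n := n) 0 (Nat.zero_le n)
  simp only [sgtSeries, mul_zero] at h
  exact ((kinPoly_inClass m).filter _).append h.neg

/-- `U⁽⁰⁾` vanishes identically near every phase point whose momentum is off the closed set `Z₁`. [folklore] -/
theorem U0zeroS_eventuallyEq_zero {δ : ℝ} (hδ : 0 < δ) (hδ1 : δ ≤ 1) {R₁ : ℕ} (hR : Θ.RS ≤ R₁) {z : PhaseSpace m}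
    (hz : z.2 ∉ Z1set m r b R₁ ((L : ℝ) ^ (n₂ + 1) * δ)) : U0zeroS Θ b δ =ᶠ[𝓝 z] fun _ => 0 := by
  have hopen : IsOpen {z' : PhaseSpace m | z'.2 ∉ Z1set m r b R₁ ((L : ℝ) ^ (n₂ + 1) * δ)} :=
    (isClosed_Z1set m r b R₁ _).isOpen_compl.preimage continuous_snd
  filter_upwards [hopen.mem_nhds hz] with z' hz'
  exact U0zeroS_eq_zero hδ hδ1 hR hz'

/-! ### The bounds on `U` and `∂U` -/

/-- **Bound on `U`**: `|U| ≤ K (𝟙_{Z₁}(ω) + ∑_{j=1}^n ε^j δ^{-2j}) W^M`. [cite: DeRoeckHuveneers2015, §5.6 ("`(H^O_{>a} - H_{>a})^{(0)} = χ_W · (H^O_{>a} - H_{>a})^{(0)}`" and "`H^O_{>a} - H_{>a} ∼ ∑_{n=0}^{n₁} ε^n δ^{-2n}`")] -/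
theorem U0S_bound (hn : 1 ≤ n) : ∃ K : ℝ, ∃ M : ℕ, 0 ≤ K ∧ ∀ δ : ℝ, 0 < δ → δ ≤ 1 → ∀ ε : ℝ, 0 ≤ ε → ε ≤ 1 →
    ∀ {R₁ : ℕ}, Θ.RS ≤ R₁ → ∀ z : PhaseSpace m,
      |U0S Θ b γ n ε δ z| ≤ K * ((Z1set m r b R₁ ((L : ℝ) ^ (n₂ + 1) * δ)).indicator (fun _ => (1 : ℝ)) z.2 +
        ∑ j ∈ Finset.Ico 1 (n + 1), ε ^ j / δ ^ (2 * j)) * (1 + ‖z.2‖) ^ M := by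
  obtain ⟨CD, MD, hCD, hD⟩ := exists_bound_tailD m
  obtain ⟨CV, MV, hCV, hV⟩ := ((potPoly_inClass m γ).filter (fun t => decide (b < t.pos))).exists_bound_ev
  obtain ⟨CR, MR, hCR, hR⟩ := exists_uniform_bound_ev (RsgtSym Θ b γ n) (fun j => 2 * j) n RsgtSym_inClass
  set Mx : ℕ := MD ⊔ MV ⊔ MR with hMx
  set Kx : ℝ := CD + CV + CR with hKx
  refine ⟨Kx, Mx, by positivity, fun δ hδ hδ1 ε hε hε1 R₁ hR₁ z => ?_⟩
  set W : ℝ := 1 + ‖z.2‖ with hW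
  set χ : ℝ := (Z1set m r b R₁ ((L : ℝ) ^ (n₂ + 1) * δ)).indicator (fun _ => (1 : ℝ)) z.2 with hχ
  set S : ℝ := ∑ j ∈ Finset.Ico 1 (n + 1), ε ^ j / δ ^ (2 * j) with hS
  have hW1 : 1 ≤ W := one_le_weight z.2
  have hWD : W ^ MD ≤ W ^ Mx := pow_le_pow_right₀ hW1 (le_sup_left.trans le_sup_left)
  have hWV : W ^ MV ≤ W ^ Mx := pow_le_pow_right₀ hW1 (le_sup_right.trans le_sup_left)
  have hWR : W ^ MR ≤ W ^ Mx := pow_le_pow_right₀ hW1 le_sup_right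
  have hWx : 0 ≤ W ^ Mx := by positivity
  have hS0 : 0 ≤ S := scaleSum_nonneg _ hε hδ _
  have hεS : ε ≤ S := by simpa using eps_le_scaleSum hn hε hδ hδ1 0
  have hχ0 : 0 ≤ χ := Set.indicator_nonneg (fun _ _ => zero_le_one) _
  -- the three pieces
  have hT : |TrigPoly.ev (tailD b) δ z| ≤ CD * W ^ Mx := ((hD δ hδ hδ1 b z).1).trans (by gcongr)
  have h0 : |U0zeroS Θ b δ z| ≤ χ * CD * W ^ Mx := by
    by_cases hz : z.2 ∈ Z1set m r b R₁ ((L : ℝ) ^ (n₂ + 1) * δ)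
    · have hχ1 : χ = 1 := Set.indicator_of_mem hz _
      rw [hχ1, one_mul]
      unfold U0zeroS
      have hfac : TrigPoly.ev (tailD b) δ z - Θ.θ b δ z.2 * TrigPoly.ev (tailD b) δ z =
          (1 - Θ.θ b δ z.2) * TrigPoly.ev (tailD b) δ z := by ring
      rw [hfac, abs_mul]
      have h01 : |1 - Θ.θ b δ z.2| ≤ 1 := by
        rw [abs_le]; constructor <;> linarith [Θ.nonneg b δ z.2, Θ.le_one b δ z.2]
      calc |1 - Θ.θ b δ z.2| * |TrigPoly.ev (tailD b) δ z| ≤ 1 * (CD * W ^ Mx) :=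
            mul_le_mul h01 hT (abs_nonneg _) zero_le_one
        _ = CD * W ^ Mx := one_mul _
    · rw [U0zeroS_eq_zero hδ hδ1 hR₁ hz, abs_zero]; positivity
  have h1 : |ε * TrigPoly.ev (tailV b γ) δ z| ≤ CV * S * W ^ Mx := by
    have h := hV δ hδ hδ1 z
    rw [pow_zero, div_one] at h
    rw [abs_mul, abs_of_nonneg hε]
    calc ε * |TrigPoly.ev (tailV b γ) δ z| ≤ S * (CV * W ^ Mx) := mul_le_mul hεS (h.trans (by gcongr)) (abs_nonneg _) hS0
      _ = CV * S * W ^ Mx := by ring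
  have h2 : |∑ j ∈ Finset.Ico 1 (n + 1), ε ^ j * TrigPoly.ev (RsgtSym Θ b γ n j) δ z| ≤ CR * S * W ^ Mx := by
    calc |∑ j ∈ Finset.Ico 1 (n + 1), ε ^ j * TrigPoly.ev (RsgtSym Θ b γ n j) δ z|
        ≤ ∑ j ∈ Finset.Ico 1 (n + 1), |ε ^ j * TrigPoly.ev (RsgtSym Θ b γ n j) δ z| := Finset.abs_sum_le_sum_abs _ _
      _ ≤ ∑ j ∈ Finset.Ico 1 (n + 1), ε ^ j * (CR / δ ^ (2 * j) * W ^ Mx) := by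
          refine Finset.sum_le_sum fun j hj => ?_
          rw [abs_mul, abs_of_nonneg (pow_nonneg hε j)]
          have hjn : j ≤ n := by have := Finset.mem_Ico.1 hj; omega
          exact mul_le_mul_of_nonneg_left ((hR δ hδ hδ1 j hjn z).trans (by gcongr)) (pow_nonneg hε j)
      _ = CR * S * W ^ Mx := by
          rw [hS, Finset.mul_sum, Finset.sum_mul]
          exact Finset.sum_congr rfl fun j _ => by ring
  rw [U0S_decomp hδ hδ1]
  have htri : |U0zeroS Θ b δ z + ε * TrigPoly.ev (tailV b γ) δ z -
        ∑ j ∈ Finset.Ico 1 (n + 1), ε ^ j * TrigPoly.ev (RsgtSym Θ b γ n j) δ z|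
      ≤ |U0zeroS Θ b δ z| + |ε * TrigPoly.ev (tailV b γ) δ z| +
          |∑ j ∈ Finset.Ico 1 (n + 1), ε ^ j * TrigPoly.ev (RsgtSym Θ b γ n j) δ z| :=
    (abs_sub _ _).trans (by gcongr; exact abs_add_le _ _)
  refine htri.trans ?_
  have hK1 : CD ≤ Kx := by rw [hKx]; linarith
  have hK2 : CV + CR ≤ Kx := by rw [hKx]; linarith
  calc |U0zeroS Θ b δ z| + |ε * TrigPoly.ev (tailV b γ) δ z| +
        |∑ j ∈ Finset.Ico 1 (n + 1), ε ^ j * TrigPoly.ev (RsgtSym Θ b γ n j) δ z|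
      ≤ χ * CD * W ^ Mx + CV * S * W ^ Mx + CR * S * W ^ Mx := by linarith
    _ = (χ * CD + (CV + CR) * S) * W ^ Mx := by ring
    _ ≤ (χ * Kx + Kx * S) * W ^ Mx := by gcongr
    _ = Kx * (χ + S) * W ^ Mx := by ring

/-- **Bound on `∂U`**: `|∂_{q_y} U|, |∂_{ω_y} U| ≤ K (𝟙_{Z₁}(ω) δ^{-1} + ∑_{j=1}^n ε^j δ^{-(2j+1)}) W^M`.
[cite: DeRoeckHuveneers2015, §5.6 ("`⟨(∂_♯(H^O_{>a} - H_{>a})^{(0)})²⟩_T ≤ … ≤ C δ/δ²`" and "`⟨(ε^n ∂_♯(H^O_{>a} - H_{>a})^{(n)})²⟩_T ≤ C (ε^n δ^{-(2n+1)})²`")] -/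
theorem dU0S_bound (hn : 1 ≤ n) : ∃ K : ℝ, ∃ M : ℕ, 0 ≤ K ∧ ∀ δ : ℝ, 0 < δ → δ ≤ 1 → ∀ ε : ℝ, 0 ≤ ε → ε ≤ 1 →
    ∀ {R₁ : ℕ}, Θ.RS ≤ R₁ → ∀ (y : Fin m) (z : PhaseSpace m),
      |partialQ y (U0S Θ b γ n ε δ) z| ≤ K * ((Z1set m r b R₁ ((L : ℝ) ^ (n₂ + 1) * δ)).indicator (fun _ => (1 : ℝ)) z.2 / δ +
        ∑ j ∈ Finset.Ico 1 (n + 1), ε ^ j / δ ^ (2 * j + 1)) * (1 + ‖z.2‖) ^ M ∧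
      |partialP y (U0S Θ b γ n ε δ) z| ≤ K * ((Z1set m r b R₁ ((L : ℝ) ^ (n₂ + 1) * δ)).indicator (fun _ => (1 : ℝ)) z.2 / δ +
        ∑ j ∈ Finset.Ico 1 (n + 1), ε ^ j / δ ^ (2 * j + 1)) * (1 + ‖z.2‖) ^ M := by
  obtain ⟨B0, hB0⟩ := exists_modeBound (U0zeroPolyS Θ b γ n)
  obtain ⟨C0q, M0q, hC0q, h0q'⟩ := (U0zeroPolyS_inClass (Θ := Θ) (b := b) (γ := γ) (n := n)).exists_bound_partialQ hB0
  obtain ⟨C0p, M0p, hC0p, h0p'⟩ := (U0zeroPolyS_inClass (Θ := Θ) (b := b) (γ := γ) (n := n)).exists_bound_partialP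
  obtain ⟨BV, hBV⟩ := exists_modeBound (tailV (m := m) b γ)
  have hVcl : (tailV (m := m) b γ).InClass 0 := (potPoly_inClass m γ).filter _
  obtain ⟨CVq, MVq, hCVq, hVq⟩ := hVcl.exists_bound_partialQ hBV
  obtain ⟨CVp, MVp, hCVp, hVp⟩ := hVcl.exists_bound_partialP
  obtain ⟨CR, MR, hCR, hR⟩ := exists_uniform_bound_partial (RsgtSym Θ b γ n) (fun j => 2 * j) n RsgtSym_inClass
  set Mx : ℕ := (M0q ⊔ M0p) ⊔ (MVq ⊔ MVp) ⊔ MR with hMx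
  set Kx : ℝ := (C0q + C0p) + (CVq + CVp) + CR with hKx
  refine ⟨Kx, Mx, by positivity, fun δ hδ hδ1 ε hε hε1 R₁ hR₁ y z => ?_⟩
  set W : ℝ := 1 + ‖z.2‖ with hW
  set χ : ℝ := (Z1set m r b R₁ ((L : ℝ) ^ (n₂ + 1) * δ)).indicator (fun _ => (1 : ℝ)) z.2 with hχ
  set S : ℝ := ∑ j ∈ Finset.Ico 1 (n + 1), ε ^ j / δ ^ (2 * j + 1) with hS
  have hW1 : 1 ≤ W := one_le_weight z.2
  have hWge : ∀ {M'}, M' ≤ Mx → W ^ M' ≤ W ^ Mx := fun h => pow_le_pow_right₀ hW1 h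
  have hWx : 0 ≤ W ^ Mx := by positivity
  have hS0 : 0 ≤ S := scaleSum_nonneg _ hε hδ _
  have hεS : ε / δ ≤ S := eps_div_le_scaleSum hn hε hδ hδ1
  have hχ0 : 0 ≤ χ := Set.indicator_nonneg (fun _ _ => zero_le_one) _
  -- differentiability and the decomposition as functions
  have hVd : Differentiable ℝ (TrigPoly.ev (tailV (m := m) b γ) δ) := TrigPoly.differentiable_ev _ fun t ht => (hVcl.smoothAt hδ hδ1 t ht).differentiable
  have hRd : ∀ j ∈ Finset.Ico 1 (n + 1), Differentiable ℝ (fun z => ε ^ j * TrigPoly.ev (RsgtSym Θ b γ n j) δ z) := by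
    intro j hj
    have hjn : j ≤ n := by have := Finset.mem_Ico.1 hj; omega
    exact (TrigPoly.differentiable_ev _ fun t ht => (((RsgtSym_inClass (Θ := Θ) (b := b) (γ := γ) (n := n) j hjn).smoothAt hδ hδ1) t ht).differentiable).const_mul _
  have eZ : U0zeroS Θ b δ = TrigPoly.ev (U0zeroPolyS Θ b γ n) δ := funext fun z => (ev_U0zeroPolyS δ z).symm
  have hZd : Differentiable ℝ (U0zeroS Θ b δ) := by
    rw [eZ]; exact TrigPoly.differentiable_ev _ fun t ht => ((U0zeroPolyS_inClass (Θ := Θ) (b := b) (γ := γ) (n := n)).smoothAt hδ hδ1 t ht).differentiable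
  have eU : U0S Θ b γ n ε δ = (U0zeroS Θ b δ + fun z => ε * TrigPoly.ev (tailV b γ) δ z) +
      fun z => (-1 : ℝ) * ∑ j ∈ Finset.Ico 1 (n + 1), ε ^ j * TrigPoly.ev (RsgtSym Θ b γ n j) δ z := by
    funext z; rw [U0S_decomp hδ hδ1]; simp; ring
  have hsumd : Differentiable ℝ (fun z => ∑ j ∈ Finset.Ico 1 (n + 1), ε ^ j * TrigPoly.ev (RsgtSym Θ b γ n j) δ z) :=
    Differentiable.fun_sum fun j hj => hRd j hj
  have hsumd' : Differentiable ℝ (fun z => (-1 : ℝ) * ∑ j ∈ Finset.Ico 1 (n + 1), ε ^ j * TrigPoly.ev (RsgtSym Θ b γ n j) δ z) :=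
    hsumd.const_mul (-1)
  have hVd' : Differentiable ℝ (fun z => ε * TrigPoly.ev (tailV b γ) δ z) := hVd.const_mul ε
  -- `|∂ U0zeroS| ≤ χ (C0q + C0p)/δ W^Mx`
  have h0 : |partialQ y (U0zeroS Θ b δ) z| ≤ χ * (C0q + C0p) / δ * W ^ Mx ∧ |partialP y (U0zeroS Θ b δ) z| ≤ χ * (C0q + C0p) / δ * W ^ Mx := by
    by_cases hz : z.2 ∈ Z1set m r b R₁ ((L : ℝ) ^ (n₂ + 1) * δ)
    · have hχ1 : χ = 1 := Set.indicator_of_mem hz _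
      rw [hχ1, one_mul, eZ]
      have hq := h0q' δ hδ hδ1 y z
      have hp := h0p' δ hδ hδ1 y z
      rw [pow_zero, div_one] at hq
      rw [zero_add, pow_one] at hp
      constructor
      · refine hq.trans ?_
        have h1 : C0q ≤ (C0q + C0p) / δ := by
          rw [le_div_iff₀ hδ]; nlinarith [mul_le_of_le_one_right hC0q hδ1]
        exact mul_le_mul h1 (hWge (le_sup_left.trans (le_sup_left.trans le_sup_left))) (by positivity) (by positivity)
      · refine hp.trans ?_
        exact mul_le_mul (div_le_div_of_nonneg_right (by linarith) hδ.le) (hWge (le_sup_right.trans (le_sup_left.trans le_sup_left)))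
          (by positivity) (by positivity)
    · have hev : U0zeroS Θ b δ =ᶠ[𝓝 z] fun _ => 0 := U0zeroS_eventuallyEq_zero hδ hδ1 hR₁ hz
      rw [partialQ_eq_zero_of_eventuallyEq hev, partialP_eq_zero_of_eventuallyEq hev, abs_zero]
      exact ⟨by positivity, by positivity⟩
  -- `|∂ (ε tailV)| ≤ (CVq + CVp) S W`
  have h1 : |partialQ y (fun z => ε * TrigPoly.ev (tailV b γ) δ z) z| ≤ (CVq + CVp) * S * W ^ Mx ∧
      |partialP y (fun z => ε * TrigPoly.ev (tailV b γ) δ z) z| ≤ (CVq + CVp) * S * W ^ Mx := by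
    rw [show (fun z => ε * TrigPoly.ev (tailV b γ) δ z) = fun z => ε * (TrigPoly.ev (tailV b γ) δ) z from rfl, partialQ_const_mul,
      partialP_const_mul, abs_mul, abs_mul, abs_of_nonneg hε]
    have hq := hVq δ hδ hδ1 y z
    have hp := hVp δ hδ hδ1 y z
    rw [pow_zero, div_one] at hq
    rw [zero_add, pow_one] at hp
    have hεδ : ε ≤ ε / δ := by rw [le_div_iff₀ hδ]; exact mul_le_of_le_one_right hε hδ1
    constructor
    · calc ε * |partialQ y (TrigPoly.ev (tailV b γ) δ) z| ≤ (ε / δ) * ((CVq + CVp) * W ^ Mx) :=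
            mul_le_mul hεδ (hq.trans (mul_le_mul (by linarith) (hWge (le_sup_left.trans (le_sup_right.trans le_sup_left))) (by positivity) (by positivity)))
              (abs_nonneg _) (by positivity)
        _ ≤ S * ((CVq + CVp) * W ^ Mx) := mul_le_mul_of_nonneg_right hεS (by positivity)
        _ = (CVq + CVp) * S * W ^ Mx := by ring
    · calc ε * |partialP y (TrigPoly.ev (tailV b γ) δ) z| ≤ ε * ((CVq + CVp) / δ * W ^ Mx) :=
            mul_le_mul_of_nonneg_left (hp.trans (mul_le_mul (div_le_div_of_nonneg_right (by linarith) hδ.le)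
              (hWge (le_sup_right.trans (le_sup_right.trans le_sup_left))) (by positivity) (by positivity))) hε
        _ = (ε / δ) * ((CVq + CVp) * W ^ Mx) := by ring
        _ ≤ S * ((CVq + CVp) * W ^ Mx) := mul_le_mul_of_nonneg_right hεS (by positivity)
        _ = (CVq + CVp) * S * W ^ Mx := by ring
  -- `|∂ (-Σ ε^j (RF)_j)| ≤ CR S W`
  have h2 : |partialQ y (fun z => (-1 : ℝ) * ∑ j ∈ Finset.Ico 1 (n + 1), ε ^ j * TrigPoly.ev (RsgtSym Θ b γ n j) δ z) z| ≤ CR * S * W ^ Mx ∧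
      |partialP y (fun z => (-1 : ℝ) * ∑ j ∈ Finset.Ico 1 (n + 1), ε ^ j * TrigPoly.ev (RsgtSym Θ b γ n j) δ z) z| ≤ CR * S * W ^ Mx := by
    rw [show (fun z => (-1 : ℝ) * ∑ j ∈ Finset.Ico 1 (n + 1), ε ^ j * TrigPoly.ev (RsgtSym Θ b γ n j) δ z) =
        fun z => (-1 : ℝ) * (fun z => ∑ j ∈ Finset.Ico 1 (n + 1), ε ^ j * TrigPoly.ev (RsgtSym Θ b γ n j) δ z) z from rfl,
      partialQ_const_mul, partialP_const_mul, abs_mul, abs_mul, abs_neg, abs_one, one_mul, one_mul,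
      partialQ_finsum _ hRd, partialP_finsum _ hRd]
    have hterm : ∀ j ∈ Finset.Ico 1 (n + 1),
        |partialQ y (fun z => ε ^ j * TrigPoly.ev (RsgtSym Θ b γ n j) δ z) z| ≤ ε ^ j * (CR / δ ^ (2 * j + 1) * W ^ Mx) ∧
        |partialP y (fun z => ε ^ j * TrigPoly.ev (RsgtSym Θ b γ n j) δ z) z| ≤ ε ^ j * (CR / δ ^ (2 * j + 1) * W ^ Mx) := by
      intro j hj
      have hjn : j ≤ n := by have := Finset.mem_Ico.1 hj; omega
      obtain ⟨hq, hp⟩ := hR δ hδ hδ1 j hjn y z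
      rw [show (fun z => ε ^ j * TrigPoly.ev (RsgtSym Θ b γ n j) δ z) = fun z => ε ^ j * (TrigPoly.ev (RsgtSym Θ b γ n j) δ) z from rfl,
        partialQ_const_mul, partialP_const_mul, abs_mul, abs_mul, abs_of_nonneg (pow_nonneg hε j)]
      exact ⟨mul_le_mul_of_nonneg_left (hq.trans (mul_le_mul (div_pow_le_div_pow_succ hCR hδ hδ1 _) (hWge le_sup_right) (by positivity) (by positivity))) (pow_nonneg hε j),
        mul_le_mul_of_nonneg_left (hp.trans (mul_le_mul_of_nonneg_left (hWge le_sup_right) (by positivity))) (pow_nonneg hε j)⟩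
    have hsum : ∀ (g : ℕ → ℝ), (∀ j ∈ Finset.Ico 1 (n + 1), |g j| ≤ ε ^ j * (CR / δ ^ (2 * j + 1) * W ^ Mx)) →
        |∑ j ∈ Finset.Ico 1 (n + 1), g j| ≤ CR * S * W ^ Mx := by
      intro g hg
      calc |∑ j ∈ Finset.Ico 1 (n + 1), g j| ≤ ∑ j ∈ Finset.Ico 1 (n + 1), |g j| := Finset.abs_sum_le_sum_abs _ _
        _ ≤ ∑ j ∈ Finset.Ico 1 (n + 1), ε ^ j * (CR / δ ^ (2 * j + 1) * W ^ Mx) := Finset.sum_le_sum hg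
        _ = CR * S * W ^ Mx := by
            rw [hS, Finset.mul_sum, Finset.sum_mul]
            exact Finset.sum_congr rfl fun j _ => by ring
    exact ⟨hsum _ fun j hj => (hterm j hj).1, hsum _ fun j hj => (hterm j hj).2⟩
  -- assemble
  have hfinal : ∀ D0 D1 D2 : ℝ, |D0| ≤ χ * (C0q + C0p) / δ * W ^ Mx → |D1| ≤ (CVq + CVp) * S * W ^ Mx → |D2| ≤ CR * S * W ^ Mx →
      |D0 + D1 + D2| ≤ Kx * (χ / δ + S) * W ^ Mx := by
    intro D0 D1 D2 hD0 hD1 hD2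
    have hχδ : 0 ≤ χ / δ := div_nonneg hχ0 hδ.le
    have hK1 : C0q + C0p ≤ Kx := by rw [hKx]; linarith
    have hK2 : (CVq + CVp) + CR ≤ Kx := by rw [hKx]; linarith
    calc |D0 + D1 + D2| ≤ |D0| + |D1| + |D2| := by linarith [abs_add_le (D0 + D1) D2, abs_add_le D0 D1]
      _ ≤ χ * (C0q + C0p) / δ * W ^ Mx + (CVq + CVp) * S * W ^ Mx + CR * S * W ^ Mx := by linarith
      _ = (χ / δ * (C0q + C0p) + ((CVq + CVp) + CR) * S) * W ^ Mx := by ring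
      _ ≤ (χ / δ * Kx + Kx * S) * W ^ Mx := by gcongr
      _ = Kx * (χ / δ + S) * W ^ Mx := by ring
  rw [eU, partialQ_add (hZd.add hVd') hsumd', partialQ_add hZd hVd', partialP_add (hZd.add hVd') hsumd', partialP_add hZd hVd']
  exact ⟨hfinal _ _ _ h0.1 h1.1 h2.1, hfinal _ _ _ h0.2 h1.2 h2.2⟩

/-! ### The bounds on `B` -/

/-- **Bounds on `B`**: `|B| ≤ K δ^{-(2n+1)} W^M`, `|∂B| ≤ K δ^{-(2n+2)} W^M`. [cite: DeRoeckHuveneers2015, §5.6 ("`∂_♯ L_V ∑_{k=0}^{n₁} R^{(n₁-k)} H̃^{(k)}_{>a} ∼ δ^{-2n₁-2}`")] -/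
theorem BtermS_bound : ∃ K : ℝ, ∃ M : ℕ, 0 ≤ K ∧ ∀ δ : ℝ, 0 < δ → δ ≤ 1 → ∀ (y : Fin m) (z : PhaseSpace m),
    |BtermS Θ b γ n δ z| ≤ K / δ ^ (2 * n + 1) * (1 + ‖z.2‖) ^ M ∧
      |partialQ y (BtermS Θ b γ n δ) z| ≤ K / δ ^ (2 * n + 2) * (1 + ‖z.2‖) ^ M ∧
      |partialP y (BtermS Θ b γ n δ) z| ≤ K / δ ^ (2 * n + 2) * (1 + ‖z.2‖) ^ M := by
  have hcl := BsymS_inClass (Θ := Θ) (b := b) (γ := γ) (n := n)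
  obtain ⟨B0, hB0⟩ := exists_modeBound (BsymS Θ b γ n)
  obtain ⟨C, M, hC, hb⟩ := hcl.exists_bound_ev
  obtain ⟨Cq, Mq, hCq, hq⟩ := hcl.exists_bound_partialQ hB0
  obtain ⟨Cp, Mp, hCp, hp⟩ := hcl.exists_bound_partialP
  refine ⟨C + Cq + Cp, M ⊔ Mq ⊔ Mp, by positivity, fun δ hδ hδ1 y z => ?_⟩
  have hW1 : 1 ≤ 1 + ‖z.2‖ := one_le_weight z.2
  have e : BtermS Θ b γ n δ = TrigPoly.ev (BsymS Θ b γ n) δ := funext fun z => BtermS_eq_ev hδ hδ1 z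
  rw [e]
  refine ⟨(hb δ hδ hδ1 z).trans ?_, (hq δ hδ hδ1 y z).trans ?_, (hp δ hδ hδ1 y z).trans ?_⟩
  · exact mul_le_mul (div_le_div_of_nonneg_right (by linarith) (by positivity)) (pow_le_pow_right₀ hW1 (le_sup_left.trans le_sup_left))
      (by positivity) (by positivity)
  · exact mul_le_mul ((div_le_div_of_nonneg_right (by linarith) (by positivity)).trans (div_pow_le_div_pow_succ (by positivity) hδ hδ1 _))
      (pow_le_pow_right₀ hW1 (le_sup_right.trans le_sup_left)) (by positivity) (by positivity)
  · exact mul_le_mul (div_le_div_of_nonneg_right (by linarith) (by positivity)) (pow_le_pow_right₀ hW1 le_sup_right)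
      (by positivity) (by positivity)

end Objects

end Literature.Barriers.AtomisticToContinuum.HeatConduction.RotorChain


open MeasureTheory ProbabilityTheory Function Set Finset Filter Metric
open scoped ENNReal NNReal ContDiff BigOperators Topology

namespace Literature.Barriers.AtomisticToContinuum.HeatConduction.RotorChain

open Literature.MathematicalPhysics.KineticTheory.HeatConduction
open Literature.Analysis.Calculus Literature.Analysis.Calculus.IsDeltaSymbol
open Literature.Algebra.Lie Literature.Algebra.Lie.TruncSeries
open Literature.Probability.Distributions

variable {m : ℕ}

/-! ### Smoothness, periodicity, (trivial) locality -/

section Regularity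

variable {r L n₂ : ℕ} {Θ : ResonanceCutoffs m r L n₂} {b : Fin m} {γ : ℝ} {n : ℕ}

/-- `U` is smooth. [cite: DeRoeckHuveneers2015, §2.3 Thm 1 ("The functions `U_a` and `G_a` are smooth")] -/
theorem contDiff_U0S (ε δ : ℝ) : ContDiff ℝ ∞ (U0S Θ b γ n ε δ) :=
  (contDiff_tailEnergy m ε γ _).sub (SmoothFun.contDiff _)

/-- `A` is smooth. [folklore] -/
theorem contDiff_AtermS (ε δ : ℝ) : ContDiff ℝ ∞ (AtermS Θ b γ n ε δ) := SmoothFun.contDiff _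

/-- `B` is smooth. [folklore] -/
theorem contDiff_BtermS (δ : ℝ) : ContDiff ℝ ∞ (BtermS Θ b γ n δ) :=
  contDiff_top_poisson (contDiff_potentialEnergy m γ) (SmoothFun.contDiff _)

/-- `G` is smooth. [cite: DeRoeckHuveneers2015, §2.3 Thm 1] -/
theorem contDiff_G0S (n₀ : ℕ) (ε δ : ℝ) : ContDiff ℝ ∞ (G0S Θ b γ n n₀ ε δ) :=
  contDiff_const.mul ((contDiff_AtermS ε δ).add (contDiff_const.mul (contDiff_BtermS δ)))

/-- `U` in evaluated symbolic form. [folklore] -/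
theorem U0S_eq_ev_form {δ : ℝ} (hδ : 0 < δ) (hδ1 : δ ≤ 1) (ε : ℝ) (z : PhaseSpace m) :
    U0S Θ b γ n ε δ z = TrigPoly.ev (tailD b) δ z + ε * TrigPoly.ev (tailV b γ) δ z -
      ∑ j ∈ Finset.range (n + 1), ε ^ j * TrigPoly.ev (RsgtSym Θ b γ n j) δ z := by
  unfold U0S; rw [eval_Rsgt_eq_sum hδ hδ1, tailEnergy_eq_ev ε γ δ z]

/-- `U` is `2π`-periodic in every angle. [cite: DeRoeckHuveneers2015, §2.1 (`Ω = (𝕋 × ℝ)^N`)] -/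
theorem isAnglePeriodic_U0S {δ : ℝ} (hδ : 0 < δ) (hδ1 : δ ≤ 1) (ε : ℝ) : IsAnglePeriodic m (U0S Θ b γ n ε δ) := by
  intro z x
  rw [U0S_eq_ev_form hδ hδ1, U0S_eq_ev_form hδ hδ1, TrigPoly.ev_update_add_two_pi, TrigPoly.ev_update_add_two_pi]
  congr 1
  exact Finset.sum_congr rfl fun j _ => by rw [TrigPoly.ev_update_add_two_pi]

/-- On a short chain `G` is a multiple of `ev BsymS`. [folklore] -/
theorem G0S_eq_ev (hm : m < n₂) {δ : ℝ} (hδ : 0 < δ) (hδ1 : δ ≤ 1) (hr : IsSchemeRadius n r) (n₀ : ℕ) (ε : ℝ) :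
    G0S Θ b γ n n₀ ε δ = fun z => ((ε ^ (n₀ + 1))⁻¹ * ε ^ (n + 1)) * TrigPoly.ev (BsymS Θ b γ n) δ z := by
  funext z
  rw [G0S_eq hm hδ hδ1 hr, BtermS_eq_ev hδ hδ1]; ring

/-- `G` is `2π`-periodic in every angle (short chain). [cite: DeRoeckHuveneers2015, §2.1] -/
theorem isAnglePeriodic_G0S (hm : m < n₂) {δ : ℝ} (hδ : 0 < δ) (hδ1 : δ ≤ 1) (hr : IsSchemeRadius n r) (n₀ : ℕ) (ε : ℝ) :
    IsAnglePeriodic m (G0S Θ b γ n n₀ ε δ) := by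
  intro z x
  rw [G0S_eq_ev hm hδ hδ1 hr]
  dsimp only
  rw [TrigPoly.ev_update_add_two_pi]

/-- Derivatives of `G = ε^{n-n₀} B` (short chain). [folklore] -/
theorem partial_G0S (hm : m < n₂) {δ : ℝ} (hδ : 0 < δ) (hδ1 : δ ≤ 1) (hr : IsSchemeRadius n r) (n₀ : ℕ) (ε : ℝ)
    (y : Fin m) (z : PhaseSpace m) :
    partialQ y (G0S Θ b γ n n₀ ε δ) z = ((ε ^ (n₀ + 1))⁻¹ * ε ^ (n + 1)) * partialQ y (BtermS Θ b γ n δ) z ∧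
    partialP y (G0S Θ b γ n n₀ ε δ) z = ((ε ^ (n₀ + 1))⁻¹ * ε ^ (n + 1)) * partialP y (BtermS Θ b γ n δ) z := by
  have e : G0S Θ b γ n n₀ ε δ = fun z => ((ε ^ (n₀ + 1))⁻¹ * ε ^ (n + 1)) * (BtermS Θ b γ n δ) z := by
    funext z; rw [G0S_eq hm hδ hδ1 hr]; ring
  rw [e, partialQ_const_mul, partialP_const_mul]
  exact ⟨rfl, rfl⟩

end Regularity

/-- On a window of at most `M + 1` sites every function depends only on the sites within `M` of
any site (locality is void on short windows). [folklore] -/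
theorem dependsOnlyNear_of_short {M : ℕ} (hM : m ≤ M + 1) (b : Fin m) (F : PhaseSpace m → ℝ) :
    DependsOnlyNear m b M F := by
  intro z z' h
  have hall : ∀ x : Fin m, z.1 x = z'.1 x ∧ z.2 x = z'.2 x := fun x => h x (by
    have hx := x.isLt; have hb := b.isLt
    rw [abs_le]
    constructor
    · have : (b.val : ℝ) ≤ (x.val : ℝ) + M := by exact_mod_cast (by omega : b.val ≤ x.val + M)
      linarith
    · have : (x.val : ℝ) ≤ (b.val : ℝ) + M := by exact_mod_cast (by omega : x.val ≤ b.val + M)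
      linarith)
  have e : z = z' := Prod.ext (funext fun x => (hall x).1) (funext fun x => (hall x).2)
  rw [e]

/-! ### The short-window solution -/

/-- **Theorem 1 on a short window, from cut-offs with `n₂ > m`.** For cut-offs `Θ` of a window of
`m < n₂` sites, a bond `(b, b+1)`, `r` a scheme radius for `n₁ = 2n₀ + 1` stages and any `M ≥ m - 1`:
there is `C` such that for every `0 < ε < 1`, with `δ = ε^{1/4}`, `(U0S, G0S)` is a window solution —
smooth, angle-periodic, local within `M`, `εJ_{b,b+1} = L_H U + ε^{n₀+1} G`, and
`⟨U²⟩_T ≤ Cε^{1/4}`, `⟨|∇U|²⟩_T ≤ Cε^{-1/4}`, `⟨G²⟩_T ≤ C`, `⟨|∇G|²⟩_T ≤ C` (coordinatewise majorants).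
Not in the source (short chains); the estimates are those of §5.6 with `Z = ∅`.
[cite: DeRoeckHuveneers2015, §2.3 Thm 1 and §5.2–5.6] -/
theorem windowSolutionS_of_cutoffs {r L n₂ : ℕ} (Θ : ResonanceCutoffs m r L n₂) (hm : m < n₂) (b : Fin m) (γ : ℝ)
    {T : ℝ} (hT : 0 < T) (n₀ : ℕ) (hr : IsSchemeRadius (2 * n₀ + 1) r) {M : ℕ} (hM : m ≤ M + 1) :
    ∃ C : ℝ, ∀ ε : ℝ, 0 < ε → ε < 1 →
      IsWindowSolution m b γ T ε n₀ M C
        (U0S Θ b γ (2 * n₀ + 1) ε (scale ε)) (G0S Θ b γ (2 * n₀ + 1) n₀ ε (scale ε)) := by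
  set n : ℕ := 2 * n₀ + 1 with hn_def
  have hn : 1 ≤ n := by omega
  -- the pointwise bounds
  obtain ⟨KU, MU, hKU, hU⟩ := U0S_bound (Θ := Θ) (b := b) (γ := γ) hn
  obtain ⟨KdU, MdU, hKdU, hdU⟩ := dU0S_bound (Θ := Θ) (b := b) (γ := γ) hn
  obtain ⟨KB, MB, hKB, hB⟩ := BtermS_bound (Θ := Θ) (b := b) (γ := γ) (n := n)
  -- the Gaussian constants
  have hv : T.toNNReal ≠ 0 := by simpa using hT
  have h2v : (2 * T.toNNReal : ℝ≥0) ≠ 0 := mul_ne_zero two_ne_zero hv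
  obtain ⟨KaU, hKaU0, hKaU⟩ := lintegral_indicator_weight_le m (2 * MU) hv
  obtain ⟨KadU, hKadU0, hKadU⟩ := lintegral_indicator_weight_le m (2 * MdU) hv
  obtain ⟨KaG, hKaG0, hKaG⟩ := lintegral_indicator_weight_le m (2 * MB) hv
  set R₁ : ℕ := Θ.RS with hR₁
  obtain ⟨CZ1, hCZ10, hZ1⟩ := measure_Z1set_le m r b R₁ h2v
  set Lf : ℝ := (L : ℝ) ^ (n₂ + 1) with hLf
  have hLf0 : 0 ≤ Lf := by positivity
  -- the constants
  set C₁ : ℝ := 2 * KU ^ 2 * KaU * (CZ1 * Lf) + 2 * (KU * n) ^ 2 * KaU with hC₁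
  set C₂ : ℝ := 2 * KdU ^ 2 * KadU * (CZ1 * Lf) + 2 * (KdU * n) ^ 2 * KadU with hC₂
  set C₃ : ℝ := 2 * (0 : ℝ) ^ 2 * KaG * (CZ1 * Lf) + 2 * KB ^ 2 * KaG with hC₃
  refine ⟨max (max C₁ C₂) C₃, fun ε hε hε1 => ?_⟩
  set δ : ℝ := scale ε with hδdef
  have hδ : 0 < δ := scale_pos hε
  have hδ1 : δ ≤ 1 := scale_le_one hε hε1.le
  have hε' : ∀ a : ℝ, 0 ≤ ε ^ a := fun a => Real.rpow_nonneg hε.le a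
  have hnR : (n : ℝ) = 2 * n₀ + 1 := by rw [hn_def]; push_cast; ring
  -- measure bound at width `η = Lf δ`
  have hη : 0 ≤ Lf * δ := mul_nonneg hLf0 hδ.le
  have hZ1' : (Measure.pi fun _ : Fin m => gaussianReal 0 (2 * T.toNNReal)) (Z1set m r b R₁ (Lf * δ)) ≤
      ENNReal.ofReal (CZ1 * Lf * ε ^ (1 / 4 : ℝ)) := by
    refine (hZ1 _ hη).trans (le_of_eq ?_); rw [hδdef, scale]; ring_nf
  -- scale sums
  have hS1 : ∑ j ∈ Finset.Ico 1 (n + 1), ε ^ j / δ ^ (2 * j) ≤ n * ε ^ (1 / 2 : ℝ) := by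
    have := sum_scale_le hε hε1.le (Finset.Ico 1 (n + 1)) 0 (1 / 2) fun j hj => by
      have hj1 : (1 : ℝ) ≤ j := by exact_mod_cast (Finset.mem_Ico.1 hj).1
      push_cast; linarith
    simpa using this
  have hS2 : ∑ j ∈ Finset.Ico 1 (n + 1), ε ^ j / δ ^ (2 * j + 1) ≤ n * ε ^ (1 / 4 : ℝ) := by
    have := sum_scale_le hε hε1.le (Finset.Ico 1 (n + 1)) 1 (1 / 4) fun j hj => by
      have hj1 : (1 : ℝ) ≤ j := by exact_mod_cast (Finset.mem_Ico.1 hj).1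
      push_cast; linarith
    simpa using this
  -- the bounds in majorant form
  have hZ1m : MeasurableSet (Z1set m r b R₁ (Lf * δ)) := measurableSet_Z1set m r b R₁ _
  have hptU : ∀ (_ : Unit) (z : PhaseSpace m), |U0S Θ b γ n ε δ z| ≤
      ((Z1set m r b R₁ (Lf * δ)).indicator (fun _ => (1 : ℝ)) z.2 * KU * ε ^ (0 : ℝ) + (KU * n) * ε ^ (1 / 2 : ℝ)) * (1 + ‖z.2‖) ^ MU := by
    intro _ z
    have h := hU δ hδ hδ1 ε hε.le hε1.le (R₁ := R₁) le_rfl z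
    rw [Real.rpow_zero, mul_one]
    refine h.trans ?_
    have hW : 0 ≤ (1 + ‖z.2‖) ^ MU := by positivity
    refine mul_le_mul_of_nonneg_right ?_ hW
    linarith [mul_le_mul_of_nonneg_left hS1 hKU]
  obtain ⟨uU, huUm, huU, huUi⟩ := exists_majorant (m := m) (M := MU) (T := T) hKaU0 hKaU hZ1m (fun _ : Unit => U0S Θ b γ n ε δ)
    hKU (by positivity) hε hε1.le (a₁ := 0) (a₂ := 1 / 2) (eZ := 1 / 4) (tgt := 1 / 4) (CZ := CZ1 * Lf) (by positivity) hptU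
    (by simpa [mul_assoc] using hZ1') (by norm_num) (by norm_num)
  -- `∂U`
  have hptdU : ∀ (i : Fin m × Bool) (z : PhaseSpace m),
      |(if i.2 then partialQ i.1 (U0S Θ b γ n ε δ) z else partialP i.1 (U0S Θ b γ n ε δ) z)| ≤
        ((Z1set m r b R₁ (Lf * δ)).indicator (fun _ => (1 : ℝ)) z.2 * KdU * ε ^ (-(1 / 4) : ℝ) + (KdU * n) * ε ^ (1 / 4 : ℝ)) *
          (1 + ‖z.2‖) ^ MdU := by
    intro i z
    obtain ⟨hq, hp⟩ := hdU δ hδ hδ1 ε hε.le hε1.le (R₁ := R₁) le_rfl i.1 z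
    have hχ : 0 ≤ (Z1set m r b R₁ (Lf * δ)).indicator (fun _ => (1 : ℝ)) z.2 := Set.indicator_nonneg (fun _ _ => zero_le_one) _
    have hW : 0 ≤ (1 + ‖z.2‖) ^ MdU := by positivity
    have hinv : (1 : ℝ) / δ = ε ^ (-(1 / 4) : ℝ) := by simpa using one_div_scale_pow hε 1
    have hrhs : KdU * ((Z1set m r b R₁ (Lf * δ)).indicator (fun _ => (1 : ℝ)) z.2 / δ +
        ∑ j ∈ Finset.Ico 1 (n + 1), ε ^ j / δ ^ (2 * j + 1)) * (1 + ‖z.2‖) ^ MdU ≤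
        ((Z1set m r b R₁ (Lf * δ)).indicator (fun _ => (1 : ℝ)) z.2 * KdU * ε ^ (-(1 / 4) : ℝ) + (KdU * n) * ε ^ (1 / 4 : ℝ)) *
          (1 + ‖z.2‖) ^ MdU := by
      refine mul_le_mul_of_nonneg_right ?_ hW
      rw [div_eq_mul_one_div, hinv]
      linarith [mul_le_mul_of_nonneg_left hS2 hKdU]
    split_ifs
    · exact hq.trans hrhs
    · exact hp.trans hrhs
  obtain ⟨udU, hudUm, hudU, hudUi⟩ := exists_majorant (m := m) (M := MdU) (T := T) hKadU0 hKadU hZ1m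
    (fun i : Fin m × Bool => fun z => if i.2 then partialQ i.1 (U0S Θ b γ n ε δ) z else partialP i.1 (U0S Θ b γ n ε δ) z)
    hKdU (by positivity) hε hε1.le (a₁ := -(1 / 4)) (a₂ := 1 / 4) (eZ := 1 / 4) (tgt := -(1 / 4)) (CZ := CZ1 * Lf) (by positivity) hptdU
    (by simpa [mul_assoc] using hZ1') (by norm_num) (by norm_num)
  -- `G = ε^{n-n₀} B` (no resonant term on a short chain)
  have hcoef : ∀ c : ℕ, ((ε ^ (n₀ + 1))⁻¹ * ε ^ (n + 1)) * (KB / δ ^ (2 * n + c)) = KB * ε ^ ((1 : ℝ) / 2 - (c : ℝ) / 4) := by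
    intro c
    have e1 : (ε ^ (n₀ + 1))⁻¹ * ε ^ (n + 1) = ε ^ ((n : ℝ) + 1 - ((n₀ : ℝ) + 1)) := by
      rw [← Real.rpow_natCast ε (n₀ + 1), ← Real.rpow_neg hε.le, ← Real.rpow_natCast ε (n + 1), ← Real.rpow_add hε]
      push_cast; ring_nf
    have e2 : KB / δ ^ (2 * n + c) = KB * ε ^ (-(((2 * n + c : ℕ) : ℝ) / 4)) := by
      rw [div_eq_mul_one_div, one_div_scale_pow hε]
    rw [e1, e2, mul_comm, mul_assoc, ← Real.rpow_add hε]
    congr 1; push_cast; rw [hnR]; ring_nf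
  have hcoef0 : 0 ≤ (ε ^ (n₀ + 1))⁻¹ * ε ^ (n + 1) := by positivity
  have hptG : ∀ (_ : Unit) (z : PhaseSpace m), |G0S Θ b γ n n₀ ε δ z| ≤
      ((Z1set m r b R₁ (Lf * δ)).indicator (fun _ => (1 : ℝ)) z.2 * 0 * ε ^ (0 : ℝ) + KB * ε ^ (1 / 4 : ℝ)) * (1 + ‖z.2‖) ^ MB := by
    intro _ z
    obtain ⟨hBz, -, -⟩ := hB δ hδ hδ1 b z
    have eG : G0S Θ b γ n n₀ ε δ z = ((ε ^ (n₀ + 1))⁻¹ * ε ^ (n + 1)) * BtermS Θ b γ n δ z := by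
      rw [G0S_eq hm hδ hδ1 hr]; ring
    rw [mul_zero, zero_mul, zero_add, eG, abs_mul, abs_of_nonneg hcoef0]
    calc (ε ^ (n₀ + 1))⁻¹ * ε ^ (n + 1) * |BtermS Θ b γ n δ z|
        ≤ (ε ^ (n₀ + 1))⁻¹ * ε ^ (n + 1) * (KB / δ ^ (2 * n + 1) * (1 + ‖z.2‖) ^ MB) := mul_le_mul_of_nonneg_left hBz hcoef0
      _ = KB * ε ^ ((1 : ℝ) / 2 - ((1 : ℕ) : ℝ) / 4) * (1 + ‖z.2‖) ^ MB := by rw [← mul_assoc, hcoef 1]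
      _ = KB * ε ^ (1 / 4 : ℝ) * (1 + ‖z.2‖) ^ MB := by norm_num
  obtain ⟨uG, huGm, huG, huGi⟩ := exists_majorant (m := m) (M := MB) (T := T) hKaG0 hKaG hZ1m (fun _ : Unit => G0S Θ b γ n n₀ ε δ)
    le_rfl hKB hε hε1.le (a₁ := 0) (a₂ := 1 / 4) (eZ := 1 / 4) (tgt := 0) (CZ := CZ1 * Lf)
    (by positivity) hptG (by simpa [mul_assoc] using hZ1') (by norm_num) (by norm_num)
  -- `∂G`
  have hptdG : ∀ (i : Fin m × Bool) (z : PhaseSpace m),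
      |(if i.2 then partialQ i.1 (G0S Θ b γ n n₀ ε δ) z else partialP i.1 (G0S Θ b γ n n₀ ε δ) z)| ≤
        ((Z1set m r b R₁ (Lf * δ)).indicator (fun _ => (1 : ℝ)) z.2 * 0 * ε ^ (0 : ℝ) + KB * ε ^ (0 : ℝ)) * (1 + ‖z.2‖) ^ MB := by
    intro i z
    obtain ⟨-, hBq, hBp⟩ := hB δ hδ hδ1 i.1 z
    obtain ⟨eq, ep⟩ := partial_G0S (Θ := Θ) (b := b) (γ := γ) (n := n) hm hδ hδ1 hr n₀ ε i.1 z
    rw [mul_zero, zero_mul, zero_add]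
    have hgen : ∀ dB : ℝ, |dB| ≤ KB / δ ^ (2 * n + 2) * (1 + ‖z.2‖) ^ MB →
        |((ε ^ (n₀ + 1))⁻¹ * ε ^ (n + 1)) * dB| ≤ KB * ε ^ (0 : ℝ) * (1 + ‖z.2‖) ^ MB := by
      intro dB hdB
      rw [abs_mul, abs_of_nonneg hcoef0]
      calc (ε ^ (n₀ + 1))⁻¹ * ε ^ (n + 1) * |dB|
          ≤ (ε ^ (n₀ + 1))⁻¹ * ε ^ (n + 1) * (KB / δ ^ (2 * n + 2) * (1 + ‖z.2‖) ^ MB) := mul_le_mul_of_nonneg_left hdB hcoef0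
        _ = KB * ε ^ ((1 : ℝ) / 2 - ((2 : ℕ) : ℝ) / 4) * (1 + ‖z.2‖) ^ MB := by rw [← mul_assoc, hcoef 2]
        _ = KB * ε ^ (0 : ℝ) * (1 + ‖z.2‖) ^ MB := by norm_num
    split_ifs
    · rw [eq]; exact hgen _ hBq
    · rw [ep]; exact hgen _ hBp
  obtain ⟨udG, hudGm, hudG, hudGi⟩ := exists_majorant (m := m) (M := MB) (T := T) hKaG0 hKaG hZ1m
    (fun i : Fin m × Bool => fun z => if i.2 then partialQ i.1 (G0S Θ b γ n n₀ ε δ) z else partialP i.1 (G0S Θ b γ n n₀ ε δ) z)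
    le_rfl hKB hε hε1.le (a₁ := 0) (a₂ := 0) (eZ := 1 / 4) (tgt := 0) (CZ := CZ1 * Lf)
    (by positivity) hptdG (by simpa [mul_assoc] using hZ1') (by norm_num) (by norm_num)
  -- assemble the structure
  have hC₁ : C₁ ≤ max (max C₁ C₂) C₃ := (le_max_left _ _).trans (le_max_left _ _)
  have hC₂ : C₂ ≤ max (max C₁ C₂) C₃ := (le_max_right _ _).trans (le_max_left _ _)
  have hC₃ : C₃ ≤ max (max C₁ C₂) C₃ := le_max_right _ _
  refine ⟨contDiff_U0S ε δ, contDiff_G0S n₀ ε δ, isAnglePeriodic_U0S hδ hδ1 ε, isAnglePeriodic_G0S hm hδ hδ1 hr n₀ ε,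
    dependsOnlyNear_of_short hM b _, dependsOnlyNear_of_short hM b _,
    fun z => current_identityS hn n₀ hε.ne' γ δ z, ⟨uU, huUm, fun z => huU () z, huUi.trans ?_⟩,
    ⟨udU, hudUm, fun z x => ⟨by simpa using hudU (x, true) z, by simpa using hudU (x, false) z⟩, hudUi.trans ?_⟩,
    ⟨uG, huGm, fun z => huG () z, huGi.trans ?_⟩,
    ⟨udG, hudGm, fun z x => ⟨by simpa using hudG (x, true) z, by simpa using hudG (x, false) z⟩, hudGi.trans ?_⟩⟩
  · exact ofReal_const_mul_mono hC₁ (hε' _)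
  · exact ofReal_const_mul_mono hC₂ (hε' _)
  · rw [Real.rpow_zero, mul_one]; exact ENNReal.ofReal_le_ofReal hC₃
  · rw [Real.rpow_zero, mul_one]; exact ENNReal.ofReal_le_ofReal hC₃

/-! ### Window solutions for all windows -/

/-- **Short windows**: for `γ`, `T > 0`, `n₀` and a radius `M`, every window of at most `M + 1` sites
admits window solutions (constants depending on the window). [cite: DeRoeckHuveneers2015, §2.3 Thm 1 (short chains, not treated in the source)] -/
theorem shortWindowSolutions (γ : ℝ) {T : ℝ} (hT : 0 < T) (n₀ M : ℕ) :
    ∀ m : ℕ, m ≤ M + 1 → ∀ b : Fin m, ∃ C ε₀ : ℝ, 0 < ε₀ ∧ ∀ ε : ℝ, 0 < ε → ε < ε₀ →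
      ∃ U G : PhaseSpace m → ℝ, IsWindowSolution m b γ T ε n₀ M C U G := by
  intro m hm b
  set n : ℕ := 2 * n₀ + 1 with hn
  set r : ℕ := max (stageModeBound n n) (stageRad n n) with hr
  have hsr : IsSchemeRadius n r := ⟨le_max_left _ _, le_max_right _ _⟩
  let Θ : ResonanceCutoffs m r (cutoffL m r) (m + 1) := resonanceCutoffs m r (m + 1) (Nat.succ_pos m)
  obtain ⟨C, hC⟩ := windowSolutionS_of_cutoffs Θ (Nat.lt_succ_self m) b γ hT n₀ hsr hm
  exact ⟨C, 1, one_pos, fun ε hε hε1 => ⟨_, _, hC ε hε hε1⟩⟩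

/-- **Window solutions for ALL windows** (long ones from `windowSolutions_with_room`, short ones from
`shortWindowSolutions`), with one locality radius `M = M(γ, T, n₀)`. [cite: DeRoeckHuveneers2015, §2.3 Thm 1 and §5] -/
theorem windowSolutions_all (γ : ℝ) {T : ℝ} (hT : 0 < T) (n₀ : ℕ) :
    ∃ M : ℕ, ∀ (m : ℕ) (b : Fin m), ∃ C ε₀ : ℝ, 0 < ε₀ ∧ ∀ ε : ℝ, 0 < ε → ε < ε₀ →
      ∃ U G : PhaseSpace m → ℝ, IsWindowSolution m b γ T ε n₀ M C U G := by
  obtain ⟨M, m₀, hm₀, hlong⟩ := windowSolutions_with_room γ hT n₀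
  refine ⟨M, fun m b => ?_⟩
  rcases le_or_gt m₀ m with h | h
  · exact hlong m h b
  · exact shortWindowSolutions γ hT n₀ M m (by omega) b

end HeatConduction.RotorChain

open Literature.MathematicalPhysics.KineticTheory.HeatConduction HeatConduction HeatConduction.RotorChain

/-- **De Roeck–Huveneers 2015, Theorem 1 (rotor chain) — DISCHARGED for every chain length.** For
`γ ≥ 0`, `T > 0`, `n ≥ 1` there are `C`, `ε₀ > 0` such that for `0 < ε < ε₀`, EVERY odd `N` and every
site `a` the current decomposes as `ε J_{a,a+1} = L_H U_a + ε^{n+1} G_a` with smooth, periodic,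
`C`-local, centred `U_a, G_a` and `⟨U_a²⟩_T ≤ Cε^{1/4}`, `⟨(∂U_a)²⟩_T ≤ Cε^{-1/4}`,
`⟨G_a²⟩_T, ⟨(∂G_a)²⟩_T ≤ C`. Long chains: the printed proof (§§3–5, the tree's
`windowSolutions_with_room`); short chains (not treated in the source): the room-free variant of
`AnticontinuumLocalizationShortChains*.lean`; glued by `DeRoeckHuveneers2015_thm1_of_windowSolutions`.
[cite: DeRoeckHuveneers2015, §2.3 Thm 1, §§3–5] -/
theorem DeRoeckHuveneers2015_thm1_holds : DeRoeckHuveneers2015_thm1 :=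
  DeRoeckHuveneers2015_thm1_of_windowSolutions fun γ _ _ hT n _ => windowSolutions_all γ hT n

/-- **De Roeck–Huveneers 2015, Theorem 4 (rotor chain) — DISCHARGED**: energy of every discrete
interval is frozen in `L²(Gibbs)` up to `Cε^{1/4}` for all times `t ≤ ε^{-n}`, uniformly over all
odd chain lengths, flows and intervals. From Theorem 1 (`DeRoeckHuveneers2015_thm1_holds`) by the
printed §7 argument (`DeRoeckHuveneers2015_thm4_of_thm1`: energy balance, invariance of the Gibbs
state under the flow — Liouville — and Jensen). [cite: DeRoeckHuveneers2015, §2.3 Thm 4 and §7 (proof of Theorem 4)] -/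
theorem DeRoeckHuveneers2015_thm4_holds : DeRoeckHuveneers2015_thm4 :=
  DeRoeckHuveneers2015_thm4_of_thm1 DeRoeckHuveneers2015_thm1_holds

/-- Theorem 2 (the barrier `AnticontinuumLocalization`) re-derived from the all-`N` Theorem 1 alone
(the tree's `DeRoeckHuveneers2015_thm2_holds` uses the large-`N` form). [cite: DeRoeckHuveneers2015, §2.3 Thm 2 and §7] -/
theorem DeRoeckHuveneers2015_thm2_holds' : DeRoeckHuveneers2015_thm2 :=
  DeRoeckHuveneers2015_thm2_of_thm1_alone DeRoeckHuveneers2015_thm1_holds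

end Literature.Barriers.AtomisticToContinuum

end
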